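import Summits.QuantumFields.YangMills.Theorems.FradkinShenkerFlowFiniteSusceptibilityWeakCouplingOddSector
import HarnessLib

/-!
# Lattice Vafa–Witten for every time-reflection plane: shifted-odd species (item stmt-QuantumFields-9442)

Support file for item stmt-QuantumFields-9442 (route `FradkinShenkerFlow` of `YangMills`), crux
`Summit.QuantumFields.YangMills.Theses.FradkinShenkerFlow.FiniteSusceptibilityWeakCoupling`, line `purity-rate-split`.
The landed `…OddSector.lean` settles STUB 0 of the line for species odd under the SITE time reflection `Θ : t ↦ −t`
(`A ∘ Θ = −A`). In `ℤ⁴` the reflections through the other time hyperplanes `t = −a/2` (`a ∈ ℤ`) read `τ_{a e₀} ∘ Θ`, and for odd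
`a` (LINK planes) a species odd under such a reflection is NOT a translate of a `Θ`-odd one. This file proves the odd-sector
theorem for ALL of them at once: if `A ∘ Θ = −A ∘ τ_{a e₀}` for some `a ∈ ℤ`, then `A` has no mirror long-range order at any
`β ≥ 0`, for every compact `G` (`stub_shiftedOddSpeciesNoMirrorLRO`). On the odd torus `L = 2S+1` the lag `a` is read in
`Fin L` (`α`), the mirror correlator is `D_A(n) = −c_A(n − α)` and the swapped one `−c_A(n + α)` (periodic lags,
`AxialSusceptibility.configShift_lag` / `cov_translates`), reflection positivity makes `c_A ≤ 0` off a cyclic window of at most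
`4R+1` lags, the axial sum rule bounds the axial `ℓ¹` norm (`ShiftedOddSector.sum_abs_le_of_sum_nonneg_off`), and the
clause-free monotonicity lemma `stub_mirrorDecorrelationOfAxialSums` concludes. Nothing here is a named fact. [folklore]
-/

noncomputable section

open MeasureTheory ProbabilityTheory Finset
open Literature.MathematicalPhysics.QuantumFieldTheory hiding Site ZdEdge
open Literature.MathematicalPhysics.QuantumLattice
open Literature.Probability.LatticeModels hiding configShift configShift_apply

namespace Summit.QuantumFields.YangMills.Theorems.FiniteSusceptibilityWeakCoupling

namespace ShiftedOddSector

open MirrorDominationAxis0 MirrorLogConvex OddSector AxialSusceptibility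

/-! ## §1 An `ℓ¹` lemma with a bad set -/

/-- **`ℓ¹` from a sign condition off a small set.** If `Σ_{i ∈ s} c i ≥ 0`, `c ≤ 0` on `s` off a finite set `O`, and
`|c| ≤ B` on `s`, then `Σ_{i ∈ s} |c i| ≤ 2 · #O · B`. [folklore] -/
theorem sum_abs_le_of_sum_nonneg_off {ι : Type*} [DecidableEq ι] (s O : Finset ι) {c : ι → ℝ} {B : ℝ}
    (hsum : 0 ≤ ∑ i ∈ s, c i) (hneg : ∀ i ∈ s, i ∉ O → c i ≤ 0) (hB : ∀ i ∈ s, |c i| ≤ B) (hB0 : 0 ≤ B) :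
    ∑ i ∈ s, |c i| ≤ 2 * O.card * B := by
  set W := s.filter (fun i => i ∉ O) with hW
  set P := s.filter (fun i => ¬(i ∉ O)) with hP
  have hsplit : ∀ f : ι → ℝ, ∑ i ∈ s, f i = ∑ i ∈ W, f i + ∑ i ∈ P, f i := fun f =>
    (sum_filter_add_sum_filter_not s (fun i => i ∉ O) f).symm
  have hPcard : (P.card : ℝ) ≤ O.card := by
    have : P ⊆ O := fun i hi => by
      rw [hP, mem_filter] at hi
      by_contra h; exact hi.2 h
    exact_mod_cast card_le_card this
  have hPabs : ∑ i ∈ P, |c i| ≤ O.card * B := by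
    calc ∑ i ∈ P, |c i| ≤ ∑ _i ∈ P, B := sum_le_sum fun i hi => by
            rw [hP, mem_filter] at hi; exact hB i hi.1
      _ = P.card * B := by rw [sum_const, nsmul_eq_mul]
      _ ≤ O.card * B := mul_le_mul_of_nonneg_right hPcard hB0
  have hWabs : ∑ i ∈ W, |c i| = -∑ i ∈ W, c i := by
    rw [← sum_neg_distrib]
    refine sum_congr rfl fun i hi => ?_
    rw [hW, mem_filter] at hi
    exact abs_of_nonpos (hneg i hi.1 hi.2)
  have hWle : -∑ i ∈ W, c i ≤ ∑ i ∈ P, |c i| := by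
    have h1 : 0 ≤ ∑ i ∈ W, c i + ∑ i ∈ P, c i := by rw [← hsplit]; exact hsum
    have h2 : ∑ i ∈ P, c i ≤ ∑ i ∈ P, |c i| := sum_le_sum fun i _ => le_abs_self _
    linarith
  rw [hsplit (fun i => |c i|), hWabs]
  linarith

/-! ## §2 Periodic lags on the odd torus -/

variable {G : Type} [Group G] [TopologicalSpace G] [IsTopologicalGroup G] [CompactSpace G]
  [MeasurableSpace G] [BorelSpace G]

omit [Group G] [TopologicalSpace G] [IsTopologicalGroup G] [CompactSpace G] [BorelSpace G] in
/-- A time translation by a multiple of the period does nothing to a lifted configuration. [folklore] -/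
theorem configShift_single_mul_period {L : ℕ} [NeZero L] (q : ℤ) (U : GaugeConfig 4 L G) :
    configShift (Pi.single 0 ((L : ℤ) * q) : Site 4) (torusLift L U) = torusLift L U := by
  refine configShift_torusLift_of_proj_eq_zero L ?_ U
  funext i
  rcases eq_or_ne i 0 with rfl | hi
  · simp [Torus.proj_apply]
  · simp [Torus.proj_apply, hi]

omit [Group G] [TopologicalSpace G] [IsTopologicalGroup G] [CompactSpace G] [BorelSpace G] in
/-- **Reading an integer time shift on the torus.** For `a ∈ ℤ` and `α = a mod L ∈ Fin L`, translating a lifted configuration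
by `a e₀` is translating it by `α e₀` (they differ by a multiple of the period). [folklore] -/
theorem configShift_single_int {L : ℕ} [NeZero L] (a : ℤ) (α : Fin L) (hα : ((α : ℕ) : ℤ) = a % L)
    (U : GaugeConfig 4 L G) :
    configShift (Pi.single 0 a : Site 4) (torusLift L U) =
      configShift (Pi.single 0 ((α : ℕ) : ℤ) : Site 4) (torusLift L U) := by
  have ha : a = (α : ℕ) + (L : ℤ) * (a / L) := by
    have h := Int.emod_add_ediv_mul a (L : ℤ)
    rw [hα]; linarith
  conv_lhs => rw [ha]
  rw [show (Pi.single 0 (((α : ℕ) : ℤ) + (L : ℤ) * (a / L)) : Site 4) =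
      Pi.single 0 ((α : ℕ) : ℤ) + Pi.single 0 ((L : ℤ) * (a / L)) from (Pi.single_add _ _ _),
    ← configShift_configShift, configShift_single_mul_period]

/-- The residue `a mod L` as an element of `Fin L`. [folklore] -/
theorem exists_fin_of_int {L : ℕ} [NeZero L] (a : ℤ) : ∃ α : Fin L, ((α : ℕ) : ℤ) = a % L := by
  have hL : (0 : ℤ) < L := by exact_mod_cast Nat.pos_of_ne_zero (NeZero.ne L)
  have h0 : 0 ≤ a % L := Int.emod_nonneg a hL.ne'
  have h1 : a % L < L := Int.emod_lt_of_pos a hL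
  refine ⟨⟨(a % L).toNat, ?_⟩, ?_⟩
  · have : ((a % L).toNat : ℤ) < L := by rw [Int.toNat_of_nonneg h0]; exact h1
    exact_mod_cast this
  · simp only [Int.toNat_of_nonneg h0]

variable (r : LatticeRep G) (β : ℝ) (A : YMSpecies G) {a : ℤ}

/-- **The mirror correlator of a shifted-odd species is minus a cyclically shifted autocorrelation**: if
`A ∘ Θ = −A ∘ τ_{a e₀}` and `α = a mod L` (`L = 2S+1`), then for `n < L`, `D_A(n) = −c_A(n − α)` with the lag read in `Fin L`.
[folklore] -/
theorem mirrorCorr_eq_neg_autocorr_sub (hodd : ∀ V, A.F (cfgReflect V) = -A.F (configShift (Pi.single 0 a) V))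
    (S : ℕ) (α : Fin (2 * S + 1)) (hα : ((α : ℕ) : ℤ) = a % (2 * S + 1 : ℕ)) (n : Fin (2 * S + 1)) :
    latticeConnectedCorr r.ρ β (2 * S + 1) A.F (fun V => A.F (cfgReflect V)) n =
      -latticeConnectedCorr r.ρ β (2 * S + 1) A.F A.F ((n - α : Fin (2 * S + 1)) : ℕ) := by
  have e1 : cov[fun U => A.F (torusLift (2 * S + 1) U),
      fun U => A.F (cfgReflect (configShift (-(Pi.single 0 ((n : ℕ) : ℤ))) (torusLift (2 * S + 1) U)));
      wilsonMeasure (d := 4) (L := 2 * S + 1) r.ρ β] =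
      latticeConnectedCorr r.ρ β (2 * S + 1) A.F (fun V => A.F (cfgReflect V)) n :=
    SiblingFunnel.covariance_eq_latticeConnectedCorr r β A (reflSpecies A) S n
  -- the reflected translate, read on the torus
  have key : ∀ U : GaugeConfig 4 (2 * S + 1) G,
      A.F (cfgReflect (configShift (-(Pi.single 0 ((n : ℕ) : ℤ))) (torusLift (2 * S + 1) U))) =
        -A.F (configShift (-(Pi.single 0 (((n - α : Fin (2 * S + 1)) : ℕ) : ℤ))) (torusLift (2 * S + 1) U)) := by
    intro U
    rw [hodd, configShift_torusLift (2 * S + 1) (-(Pi.single 0 ((n : ℕ) : ℤ))) U,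
      configShift_single_int a α hα, ← configShift_torusLift, configShift_configShift, add_comm,
      configShift_lag α n U]
  rw [← e1]
  simp only [key, covariance_fun_neg_right]
  rw [← cov_translate_left r.ρ β A.F A.F (a := (0 : Site 4)) (b := -(Pi.single 0 (((n - α : Fin (2 * S + 1)) : ℕ) : ℤ)))
      (by rw [add_zero])]
  simp only [neg_zero, configShift_zero]
  rw [SiblingFunnel.covariance_eq_latticeConnectedCorr r β A A S _]

/-- **The swapped correlator of a shifted-odd species**: for `n < L`, `⟨(A∘Θ) · τ_n A⟩ − ⟨A∘Θ⟩⟨A⟩ = −c_A(n + α)`. [folklore] -/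
theorem swappedCorr_eq_neg_autocorr_add (hodd : ∀ V, A.F (cfgReflect V) = -A.F (configShift (Pi.single 0 a) V))
    (S : ℕ) (α : Fin (2 * S + 1)) (hα : ((α : ℕ) : ℤ) = a % (2 * S + 1 : ℕ)) (n : Fin (2 * S + 1)) :
    latticeConnectedCorr r.ρ β (2 * S + 1) (fun V => A.F (cfgReflect V)) A.F n =
      -latticeConnectedCorr r.ρ β (2 * S + 1) A.F A.F ((n + α : Fin (2 * S + 1)) : ℕ) := by
  have e2 : cov[fun U => A.F (cfgReflect (torusLift (2 * S + 1) U)),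
      fun U => A.F (configShift (-(Pi.single 0 ((n : ℕ) : ℤ))) (torusLift (2 * S + 1) U));
      wilsonMeasure (d := 4) (L := 2 * S + 1) r.ρ β] =
      latticeConnectedCorr r.ρ β (2 * S + 1) (fun V => A.F (cfgReflect V)) A.F n :=
    SiblingFunnel.covariance_eq_latticeConnectedCorr r β (reflSpecies A) A S n
  have key : ∀ U : GaugeConfig 4 (2 * S + 1) G, A.F (cfgReflect (torusLift (2 * S + 1) U)) =
      -A.F (configShift (-(Pi.single 0 (((-α : Fin (2 * S + 1)) : ℕ) : ℤ))) (torusLift (2 * S + 1) U)) := by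
    intro U
    rw [hodd, configShift_single_int a α hα, ← zero_sub α, ← configShift_lag α 0 U]
    simp
  rw [← e2]
  simp only [key, covariance_fun_neg_left]
  rw [cov_translates r β A S (-α) n, sub_neg_eq_add]

/-! ## §3 The cyclic window and the `ℓ¹` bound -/

/-- **Volume-uniform axial `ℓ¹` bound for a shifted-odd species** (every compact `G`, `β ≥ 0`): with `R` exceeding the time
coordinates of `supp A` by two, `Σ_{m<2S+1} |c_A^{(S)}(m)| ≤ 2(4R+1)·B` for every `S` (`B` a bound of `|c_A|`). The lags where the
sign of `c_A` is not controlled are the `α`-translates of `[0, 2R] ∪ [2S−2R+1, 2S]`. [folklore] -/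
theorem sum_abs_autocorr_le (hβ : 0 ≤ β)
    (hodd : ∀ V, A.F (cfgReflect V) = -A.F (configShift (Pi.single 0 a) V)) {R : ℕ}
    (hRA : ∀ e ∈ A.supp, (e.1 0).natAbs + 2 ≤ R) {B : ℝ}
    (hB : ∀ S n : ℕ, |latticeConnectedCorr r.ρ β (2 * S + 1) A.F A.F n| ≤ B) (S : ℕ) :
    ∑ m ∈ range (2 * S + 1), |latticeConnectedCorr r.ρ β (2 * S + 1) A.F A.F m| ≤ 2 * (4 * R + 1) * B := by
  classical
  obtain ⟨α, hα⟩ := exists_fin_of_int (L := 2 * S + 1) a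
  have hB0 : 0 ≤ B := (abs_nonneg _).trans (hB 0 0)
  -- the bad lags and their `α`-translates
  set O' : Finset (Fin (2 * S + 1)) :=
    univ.filter (fun n : Fin (2 * S + 1) => (n : ℕ) < 2 * R + 1 ∨ 2 * S < (n : ℕ) + 2 * R) with hO'
  set O : Finset (Fin (2 * S + 1)) := O'.image (fun n => n - α) with hO
  have hO'card : O'.card ≤ 4 * R + 1 := by
    have hinj : Set.InjOn (fun n : Fin (2 * S + 1) => (n : ℕ)) ↑O' := fun x _ y _ h => Fin.ext h
    have hmap : ∀ n ∈ O', (n : ℕ) ∈ range (2 * R + 1) ∪ Ico (2 * S + 1 - 2 * R) (2 * S + 1) := by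
      intro n hn
      rw [hO', mem_filter] at hn
      have := n.isLt
      rw [mem_union, mem_range, mem_Ico]
      omega
    calc O'.card ≤ (range (2 * R + 1) ∪ Ico (2 * S + 1 - 2 * R) (2 * S + 1)).card :=
          card_le_card_of_injOn _ hmap hinj
      _ ≤ (range (2 * R + 1)).card + (Ico (2 * S + 1 - 2 * R) (2 * S + 1)).card := card_union_le _ _
      _ ≤ 4 * R + 1 := by rw [card_range, Nat.card_Ico]; omega
  have hOcard : (O.card : ℝ) ≤ 4 * R + 1 := by
    have : O.card ≤ 4 * R + 1 := card_image_le.trans hO'card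
    exact_mod_cast this
  -- the sum over `Fin (2S+1)`
  rw [sum_range]
  have hsum : 0 ≤ ∑ m : Fin (2 * S + 1), latticeConnectedCorr r.ρ β (2 * S + 1) A.F A.F m := by
    rw [← sum_range]; exact stub_axialSusceptibilityNonneg G r β A S
  have hneg : ∀ m ∈ (univ : Finset (Fin (2 * S + 1))), m ∉ O →
      latticeConnectedCorr r.ρ β (2 * S + 1) A.F A.F m ≤ 0 := by
    intro m _ hm
    -- `m + α` is a good lag
    have hgood : ¬(((m + α : Fin (2 * S + 1)) : ℕ) < 2 * R + 1 ∨ 2 * S < ((m + α : Fin (2 * S + 1)) : ℕ) + 2 * R) := by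
      intro h
      apply hm
      rw [hO, mem_image]
      refine ⟨m + α, ?_, add_sub_cancel_right m α⟩
      rw [hO', mem_filter]
      exact ⟨mem_univ _, h⟩
    push Not at hgood
    have hD := mirrorCorr_nonneg r hβ A hRA (S := S) (m := ((m + α : Fin (2 * S + 1)) : ℕ)) (by omega) (by omega)
    rw [show (((m + α : Fin (2 * S + 1)) : ℕ)) = ((m + α : Fin (2 * S + 1)) : ℕ) from rfl,
      mirrorCorr_eq_neg_autocorr_sub r β A hodd S α hα (m + α), add_sub_cancel_right] at hD
    linarith
  calc ∑ m : Fin (2 * S + 1), |latticeConnectedCorr r.ρ β (2 * S + 1) A.F A.F m|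
      ≤ 2 * O.card * B :=
        sum_abs_le_of_sum_nonneg_off univ O hsum hneg (fun m _ => hB S m) hB0
    _ ≤ 2 * (4 * R + 1) * B := by nlinarith

/-! ## §4 Assembly -/

/-- **A shifted-odd species has no mirror long-range order** (every compact `G`, `β ≥ 0`): the axial `ℓ¹` norms of the mirror
correlator and of the swapped correlator are the `ℓ¹` norm of `c_A` (cyclic reindexing), bounded uniformly in the volume, and
`stub_mirrorDecorrelationOfAxialSums` concludes. [folklore] -/
theorem noMirrorLRO (hβ : 0 ≤ β) (hodd : ∀ V, A.F (cfgReflect V) = -A.F (configShift (Pi.single 0 a) V))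
    {ε : ℝ} (hε : 0 < ε) :
    ∃ j₀ : ℕ, ∀ S j : ℕ, j₀ ≤ j → j ≤ S →
      |latticeConnectedCorr r.ρ β (2 * S + 1) A.F (fun V => A.F (cfgReflect V)) j| ≤ ε := by
  classical
  -- the time extent `R` of `A` and the bound `B` on `|c_A|`
  obtain ⟨R, hRA⟩ : ∃ R : ℕ, ∀ e ∈ A.supp, (e.1 0).natAbs + 2 ≤ R := by
    refine ⟨(A.supp.sup fun e => (e.1 0).natAbs) + 2, fun e he => ?_⟩
    have := Finset.le_sup (f := fun e : ZdEdge 4 => (e.1 0).natAbs) he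
    omega
  obtain ⟨B, hB⟩ := abs_autocorr_le r β A
  have hC := sum_abs_autocorr_le r β A hβ hodd hRA hB
  set C := 2 * (4 * (R : ℝ) + 1) * B with hCdef
  -- the two axial sums of the clause-free monotonicity lemma
  have hax₁ : ∀ S : ℕ, ∑ i ∈ range (S + 1),
      |latticeConnectedCorr r.ρ β (2 * S + 1) A.F (fun V => A.F (cfgReflect V)) i| ≤ C := by
    intro S
    obtain ⟨α, hα⟩ := exists_fin_of_int (L := 2 * S + 1) a
    calc ∑ i ∈ range (S + 1), |latticeConnectedCorr r.ρ β (2 * S + 1) A.F (fun V => A.F (cfgReflect V)) i|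
        ≤ ∑ i ∈ range (2 * S + 1), |latticeConnectedCorr r.ρ β (2 * S + 1) A.F (fun V => A.F (cfgReflect V)) i| :=
          sum_le_sum_of_subset_of_nonneg (range_subset_range.2 (by omega)) (fun i _ _ => abs_nonneg _)
      _ = ∑ i : Fin (2 * S + 1), |latticeConnectedCorr r.ρ β (2 * S + 1) A.F A.F ((i - α : Fin (2 * S + 1)) : ℕ)| := by
          rw [sum_range]
          exact sum_congr rfl fun i _ => by rw [mirrorCorr_eq_neg_autocorr_sub r β A hodd S α hα i, abs_neg]
      _ = ∑ m : Fin (2 * S + 1), |latticeConnectedCorr r.ρ β (2 * S + 1) A.F A.F m| :=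
          Equiv.sum_comp (Equiv.subRight α)
            (fun m : Fin (2 * S + 1) => |latticeConnectedCorr r.ρ β (2 * S + 1) A.F A.F m|)
      _ = ∑ m ∈ range (2 * S + 1), |latticeConnectedCorr r.ρ β (2 * S + 1) A.F A.F m| :=
          (sum_range (fun m => |latticeConnectedCorr r.ρ β (2 * S + 1) A.F A.F m|)).symm
      _ ≤ C := hC S
  have hax₂ : ∀ S : ℕ, ∑ i ∈ range (S + 1),
      |latticeConnectedCorr r.ρ β (2 * S + 1) (fun V => A.F (cfgReflect V)) A.F i| ≤ C := by
    intro S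
    obtain ⟨α, hα⟩ := exists_fin_of_int (L := 2 * S + 1) a
    calc ∑ i ∈ range (S + 1), |latticeConnectedCorr r.ρ β (2 * S + 1) (fun V => A.F (cfgReflect V)) A.F i|
        ≤ ∑ i ∈ range (2 * S + 1), |latticeConnectedCorr r.ρ β (2 * S + 1) (fun V => A.F (cfgReflect V)) A.F i| :=
          sum_le_sum_of_subset_of_nonneg (range_subset_range.2 (by omega)) (fun i _ _ => abs_nonneg _)
      _ = ∑ i : Fin (2 * S + 1), |latticeConnectedCorr r.ρ β (2 * S + 1) A.F A.F ((i + α : Fin (2 * S + 1)) : ℕ)| := by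
          rw [sum_range]
          exact sum_congr rfl fun i _ => by rw [swappedCorr_eq_neg_autocorr_add r β A hodd S α hα i, abs_neg]
      _ = ∑ m : Fin (2 * S + 1), |latticeConnectedCorr r.ρ β (2 * S + 1) A.F A.F m| :=
          Equiv.sum_comp (Equiv.addRight α)
            (fun m : Fin (2 * S + 1) => |latticeConnectedCorr r.ρ β (2 * S + 1) A.F A.F m|)
      _ = ∑ m ∈ range (2 * S + 1), |latticeConnectedCorr r.ρ β (2 * S + 1) A.F A.F m| :=
          (sum_range (fun m => |latticeConnectedCorr r.ρ β (2 * S + 1) A.F A.F m|)).symm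
      _ ≤ C := hC S
  exact stub_mirrorDecorrelationOfAxialSums G r β hβ A C hax₁ hax₂ ε hε

end ShiftedOddSector

/-- **Registered sub-goal `stub_shiftedOddSpeciesNoMirrorLRO`** of item stmt-QuantumFields-9442 (signature verbatim, fully qualified) —
**lattice Vafa–Witten for every time-reflection plane**: for every compact `G`, every lattice representation, every `β ≥ 0`, every
`a ∈ ℤ` and every gauge-invariant local observable with `A ∘ Θ = −A ∘ τ_{a e₀}` (odd under the time reflection through the hyperplane
`t = −a/2`: site planes for even `a`, LINK planes for odd `a`), the mirror correlator tends to zero uniformly in the odd tori —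
the whole time-reflection-odd sector of STUB 0 of line `purity-rate-split` is a theorem. [folklore] -/
theorem stub_shiftedOddSpeciesNoMirrorLRO : ∀ (G : Type) [Group G] [TopologicalSpace G] [IsTopologicalGroup G] [CompactSpace G] [MeasurableSpace G] [BorelSpace G] (r : Literature.MathematicalPhysics.QuantumFieldTheory.LatticeRep G) (β : ℝ), 0 ≤ β → ∀ (A : Literature.MathematicalPhysics.QuantumFieldTheory.YMSpecies G) (a : ℤ), (∀ V, A.F (Literature.MathematicalPhysics.QuantumFieldTheory.cfgReflect V) = -A.F (Literature.MathematicalPhysics.QuantumLattice.configShift (Pi.single 0 a : Literature.Probability.LatticeModels.Site 4) V)) → ∀ ε : ℝ, 0 < ε → ∃ j₀ : ℕ, ∀ S j : ℕ, j₀ ≤ j → j ≤ S → |Literature.MathematicalPhysics.QuantumFieldTheory.latticeConnectedCorr r.ρ β (2 * S + 1) A.F (fun V => A.F (Literature.MathematicalPhysics.QuantumFieldTheory.cfgReflect V)) j| ≤ ε :=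
  fun _G _ _ _ _ _ _ r β hβ A _a hodd _ε hε => ShiftedOddSector.noMirrorLRO r β A hβ hodd hε

end Summit.QuantumFields.YangMills.Theorems.FiniteSusceptibilityWeakCoupling

end
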